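import Literature.Geometry.Kaehler.ComplexTorusHilbertModularCuspStabilizerFrameExpansion
import Literature.Geometry.Kaehler.ComplexTorusHilbertModularUniversalClassExact
import Literature.LinearAlgebra.Alternating.WedgeOne
import HarnessLib

/-!
# The sector decomposition of a `Γ_∞`-invariant form on `ℍⁿ` by the `dx`-content of Freitag's frame
# (Freitag, *Hilbert Modular Forms*, Ch. III §2, proof of Prop. 2.1, pp. 143–145)

Geometry/Kaehler ∕ NumberTheory/Automorphic support file, sequel of `…CuspStabilizerFrameExpansion` (the expansion
`ω_z = Σ_t formCoeff ω t z • coordForm (frameSymbols t) z` in the frame `dx_σ, dy_σ/y_σ`). Everything proved;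
definitions with bodies, no named fact. (The «sectors» of this file are sets of SYMBOLS `dx_σ`; they are unrelated to
the Siegel cusp sectors of `…CuspSector`.)

In the proof of Prop. III.2.1 an invariant form is written `ω = Σ_{a,b} f_{ab} dx_a ∧ dy_b/y_b` and the terms are
grouped by the set `a` of `x`-differentials they contain: under `z ↦ εz + b` the term `dx_a ∧ dy_b/y_b` picks up the
character `Π_{σ ∈ a} σ(ε)`, which depends on `a` only. This file makes the grouping:

* §1 three pieces of calculus: the Leibniz rule `d(f • η) = df ∧ η + f • dη` for the tree's `wedgeOne`
  (`extDeriv_smul_eq_wedgeOne_add`), the frame identity `((coordWeight z s)⁻¹ c_s) ∧ (c_1 ∧ ⋯ ∧ c_k) = (s, c_1, …, c_k)`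
  on `ℍⁿ` (`wedgeOne_coordForm`), and the vanishing of the real directional derivatives of an `x`-independent
  function (`fderiv_realToPoint_eq_zero`);
* §2 the `dx`-content `xPart t ⊂ Hom(F, ℝ)` of an index, the pointwise SECTOR predicate `IsInSector I z φ` («the
  coefficients of `φ` at `z` outside the indices with `xPart = I` vanish») and the INDEPENDENCE OF SECTORS
  (`eq_zero_of_sum_eq_zero_of_isInSector`); a form `(s, c_t)` with `s = dy_σ/y_σ` prepended stays in the sector of `t`
  (`coordForm_cons_inr_isInSector`);
* §3 the SECTOR PIECES `sectorPiece ω I = Σ_{xPart t = I} formCoeff ω t • coordForm (frameSymbols t)`: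
  `Σ_I sectorPiece ω I = ω` (for `ω` vanishing off `ℍⁿ`), smooth on `ℍⁿ`, in their sectors, and
  **`Γ_∞`-invariant whenever `ω` is** (`sectorPiece_mem_invariantForms`);
* §4 **for an `x`-INDEPENDENT closed invariant `ω` every sector piece is closed** (`sectorPiece_mem_closedForms`):
  `d(f_t • c_t) = Σ_σ df_t(y_σ i e_σ) • (dy_σ/y_σ, c_t)` raises only `dy/y`-symbols, so `d(sectorPiece ω I)` lies in
  sector `I`, and `Σ_I d(sectorPiece ω I) = dω = 0` forces each term to vanish; consequently
  `[ω] = Σ_I [sectorPiece ω I]` in `H^k((ℍⁿ, Γ_∞))` (`mk_eq_sum_mk_sectorPiece`).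

## References

* [Freitag1990] E. Freitag, *Hilbert Modular Forms*, Springer (1990): Ch. III §2, Prop. 2.1 and its proof,
  pp. 143–145.
* [Warner1983] F. Warner, *Foundations of Differentiable Manifolds and Lie Groups*, GTM 94 (1983): 2.10–2.13
  (exterior product, `d` is an antiderivation).
-/

noncomputable section

/- Instance search through the form spaces `Point F [⋀^Fin p]→L[ℝ] ℂ` nests pending instance problems three deep
(see `…HilbertModularInvariantForms`). -/
set_option maxSynthPendingDepth 3

open scoped Matrix MatrixGroups Classical Topology ContDiff

open Set Function Filter Complex ContinuousAlternatingMap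

namespace Literature.NumberTheory.Automorphic.HilbertModular

open _root_.NumberField Module
open Literature.Geometry.Kaehler.ComplexTorus.HilbertModularFamily
open Literature.LinearAlgebra.Alternating (wedgeOne wedgeOne_apply wedgeOne_add_left wedgeOne_smul_left)
open Literature.NumberTheory.Automorphic (HilbertModular.deRhamCohomology.mk)

variable {F : Type*} [Field F] [NumberField F] [IsTotallyReal F]

/-! ## §1 Calculus: Leibniz rule, wedge with a frame covector, real directional derivatives -/

section Calculus

/-- **Leibniz rule `d(f • η) = df ∧ η + f • dη`** at a point of differentiability, with the tree's `wedgeOne`.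
[cite: Warner1983, 2.13 («`d(fω) = df ∧ ω + f dω`»)] -/
theorem extDeriv_smul_eq_wedgeOne_add {E : Type*} [NormedAddCommGroup E] [NormedSpace ℝ E] {n : ℕ} {f : E → ℂ}
    {η : E → E [⋀^Fin n]→L[ℝ] ℂ} {x : E} (hf : DifferentiableAt ℝ f x) (hη : DifferentiableAt ℝ η x) :
    extDeriv (fun y => f y • η y) x = wedgeOne (fderiv ℝ f x) (η x) + f x • extDeriv η x := by
  ext v
  have hd : DifferentiableAt ℝ (fun y => f y • η y) x := hf.smul hη
  rw [extDeriv_apply hd v, ContinuousAlternatingMap.add_apply, ContinuousAlternatingMap.smul_apply,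
    wedgeOne_apply, extDeriv_apply hη v, Finset.smul_sum, ← Finset.sum_add_distrib]
  refine Finset.sum_congr rfl fun i _ => ?_
  have hg : DifferentiableAt ℝ (fun y => η y (i.removeNth v)) x := hη.continuousAlternatingMap_apply_const _
  have h1 : (fun y => (f y • η y) (i.removeNth v)) = f * fun y => η y (i.removeNth v) := rfl
  rw [h1, (hf.hasFDerivAt.mul hg.hasFDerivAt).fderiv]
  simp only [_root_.add_apply, FunLike.coe_smul, Pi.smul_apply, smul_eq_mul, smul_add]
  ring

omit [IsTotallyReal F] in
/-- The complexification of a real covector named by a symbol, divided by its weight: the covector DUAL to the frame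
vector `frameVec z s` (`dx_σ`, resp. `dy_σ/y_σ`, at `z`). [cite: Freitag1990, Ch. III §2, p. 143] -/
def frameCovector (z : Point F) (s : (F →+* ℝ) ⊕ (F →+* ℝ)) : Point F →L[ℝ] ℂ :=
  ((coordWeight z s)⁻¹ : ℝ) • Complex.ofRealCLM.comp (coordCLM s)

omit [NumberField F] [IsTotallyReal F] in
/-- `frameCovector z s v = (coordWeight z s)⁻¹ c_s(v)`. [cite: Freitag1990, Ch. III §2, p. 143] -/
@[simp]
theorem frameCovector_apply (z : Point F) (s : (F →+* ℝ) ⊕ (F →+* ℝ)) (v : Point F) :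
    frameCovector z s v = (((coordWeight z s)⁻¹ * coordCLM s v : ℝ) : ℂ) := by
  simp [frameCovector, Complex.real_smul]

omit [NumberField F] [IsTotallyReal F] in
/-- The frame covectors are dual to the frame vectors: `frameCovector z s (frameVec z s') = δ_{ss'}` on `ℍⁿ`.
[cite: Freitag1990, Ch. III §2, p. 143] -/
theorem frameCovector_frameVec {z : Point F} (hz : z ∈ halfSpace F) (s s' : (F →+* ℝ) ⊕ (F →+* ℝ)) :
    frameCovector z s (frameVec z s') = if s = s' then 1 else 0 := by
  rw [frameCovector_apply, coordCLM_frameVec]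
  split_ifs with h
  · rw [inv_mul_cancel₀ (coordWeight_pos hz s).ne', Complex.ofReal_one]
  · rw [mul_zero, Complex.ofReal_zero]

omit [IsTotallyReal F] in
/-- **A complex covector expands in the frame covectors**: `ℓ = Σ_s ℓ(frameVec z s) • frameCovector z s` (`z ∈ ℍⁿ`).
[cite: Freitag1990, Ch. III §2, p. 143] -/
theorem eq_sum_apply_frameVec_smul_frameCovector {z : Point F} (hz : z ∈ halfSpace F) (ℓ : Point F →L[ℝ] ℂ) :
    ℓ = ∑ s, ℓ (frameVec z s) • frameCovector z s := by
  apply ContinuousLinearMap.coe_injective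
  refine (frameBasis hz).ext fun s' => ?_
  change ℓ (frameBasis hz s') = (∑ s, ℓ (frameVec z s) • frameCovector z s) (frameBasis hz s')
  rw [frameBasis_apply, _root_.sum_apply]
  simp only [_root_.smul_apply, frameCovector_frameVec hz, smul_eq_mul, mul_ite, mul_one, mul_zero,
    Finset.sum_ite_eq', Finset.mem_univ, if_true]

omit [IsTotallyReal F] in
/-- **`frameCovector z s ∧ (c_1 ∧ ⋯ ∧ c_k) = (s, c_1, …, c_k)` at `z ∈ ℍⁿ`** (Laplace expansion along the first column).
[cite: Freitag1990, Ch. III §1, p. 133 («`dω = Σ … ∧ dx_a`»)] -/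
theorem wedgeOne_coordForm {k : ℕ} (s : (F →+* ℝ) ⊕ (F →+* ℝ)) (c : Fin k → (F →+* ℝ) ⊕ (F →+* ℝ)) {z : Point F}
    (hz : z ∈ halfSpace F) :
    wedgeOne (frameCovector z s) (coordForm c z) = coordForm (Fin.cons s c : Fin (k + 1) → (F →+* ℝ) ⊕ (F →+* ℝ)) z := by
  ext v
  have hcons : (Fin.cons s c : Fin (k + 1) → (F →+* ℝ) ⊕ (F →+* ℝ)) = Fin.insertNth 0 s c := by
    funext j; refine Fin.cases ?_ (fun j' => ?_) j <;> simp [Fin.insertNth_zero']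
  have key : ∑ i : Fin (k + 1), (-1 : ℝ) ^ (i : ℕ) * coordCLM s (v i) *
      (Matrix.of fun i' j => coordCLM (c j) (Fin.removeNth i v i')).det =
      (Matrix.of fun i j => coordCLM ((Fin.cons s c : Fin (k + 1) → (F →+* ℝ) ⊕ (F →+* ℝ)) j) (v i)).det := by
    rw [hcons]
    simpa using sum_neg_one_pow_mul_coordCLM_mul_det c s 0 v
  have hw : (∏ j : Fin (k + 1), coordWeight z ((Fin.cons s c : Fin (k + 1) → (F →+* ℝ) ⊕ (F →+* ℝ)) j)) =
      coordWeight z s * ∏ j, coordWeight z (c j) := by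
    rw [Fin.prod_univ_succ]; simp
  rw [wedgeOne_apply, coordForm_apply_of_mem _ hz, hw, ← key]
  simp only [coordForm_apply_of_mem _ hz, frameCovector_apply, Complex.real_smul, smul_eq_mul]
  push_cast
  rw [Finset.mul_sum]
  refine Finset.sum_congr rfl fun i _ => ?_
  simp only [zsmul_eq_mul, Int.cast_pow, Int.cast_neg, Int.cast_one]
  ring

omit [IsTotallyReal F] in
/-- **Real directional derivatives of an `x`-independent function vanish**: if `f(z + b) = f(z)` for all real `b`,
then `df(z)(b) = 0`. [cite: Freitag1990, Ch. III §2, p. 145 («independent of `x`»)] -/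
theorem fderiv_realToPoint_eq_zero {V : Type*} [NormedAddCommGroup V] [NormedSpace ℝ V] {f : Point F → V}
    (hf : ∀ z x, f (z + realToPoint F x) = f z) {z : Point F} (hd : DifferentiableAt ℝ f z) (x : (F →+* ℝ) → ℝ) :
    fderiv ℝ f z (realToPoint F x) = 0 := by
  have hline : HasDerivAt (fun t : ℝ => f (z + t • realToPoint F x)) (fderiv ℝ f z (realToPoint F x)) 0 := by
    have h1 : HasDerivAt (fun t : ℝ => z + t • realToPoint F x) (realToPoint F x) 0 := by
      simpa using ((hasDerivAt_id (0 : ℝ)).smul_const (realToPoint F x)).const_add z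
    have h2 : HasFDerivAt f (fderiv ℝ f z) (z + (0 : ℝ) • realToPoint F x) := by
      rw [zero_smul, add_zero]; exact hd.hasFDerivAt
    exact h2.comp_hasDerivAt (0 : ℝ) h1
  have hconst : (fun t : ℝ => f (z + t • realToPoint F x)) = fun _ => f z := by
    funext t
    rw [show t • realToPoint F x = realToPoint F (t • x) by rw [map_smul], hf]
  rw [hconst] at hline
  exact hline.unique (hasDerivAt_const 0 (f z)) ▸ rfl

end Calculus

/-! ## §2 The `dx`-content of an index and the pointwise sectors -/

section Sector

variable {k : ℕ}

/-- **The `dx`-content of an index**: `xPart t = {σ : dx_σ occurs in the list of t}` (Freitag's `a` in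
`dx_a ∧ dy_b/y_b`). [cite: Freitag1990, Ch. III §2, p. 145] -/
def xPart (t : FrameIdx F k) : Finset (F →+* ℝ) :=
  Finset.univ.filter fun σ => Sum.inl σ ∈ Set.range (frameSymbols t)

omit [IsTotallyReal F] in
/-- `σ ∈ xPart t ↔ dx_σ` occurs in `t`. [cite: Freitag1990, Ch. III §2, p. 145] -/
theorem mem_xPart_iff (t : FrameIdx F k) (σ : F →+* ℝ) : σ ∈ xPart t ↔ Sum.inl σ ∈ Set.range (frameSymbols t) := by
  simp [xPart]

/-- **The sector predicate**: a covector `φ` at `z` lies in the sector `I` if its frame coefficients vanish at every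
index whose `dx`-content is not `I`. [cite: Freitag1990, Ch. III §2, p. 145] -/
def IsInSector (I : Finset (F →+* ℝ)) (z : Point F) (φ : Point F [⋀^Fin k]→L[ℝ] ℂ) : Prop :=
  ∀ t : FrameIdx F k, xPart t ≠ I → φ (frameTuple z t) = 0

omit [IsTotallyReal F] in
/-- `0` lies in every sector. [cite: Freitag1990, Ch. III §2, p. 145] -/
theorem isInSector_zero (I : Finset (F →+* ℝ)) (z : Point F) : IsInSector I z (0 : Point F [⋀^Fin k]→L[ℝ] ℂ) :=
  fun _ _ => rfl

omit [IsTotallyReal F] in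
/-- Sectors are closed under addition. [cite: Freitag1990, Ch. III §2, p. 145] -/
theorem IsInSector.add {I : Finset (F →+* ℝ)} {z : Point F} {φ ψ : Point F [⋀^Fin k]→L[ℝ] ℂ} (hφ : IsInSector I z φ)
    (hψ : IsInSector I z ψ) : IsInSector I z (φ + ψ) := fun t ht => by
  rw [ContinuousAlternatingMap.add_apply, hφ t ht, hψ t ht, add_zero]

omit [IsTotallyReal F] in
/-- Sectors are closed under scalars. [cite: Freitag1990, Ch. III §2, p. 145] -/
theorem IsInSector.smul {I : Finset (F →+* ℝ)} {z : Point F} {φ : Point F [⋀^Fin k]→L[ℝ] ℂ} (hφ : IsInSector I z φ)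
    (a : ℂ) : IsInSector I z (a • φ) := fun t ht => by
  rw [ContinuousAlternatingMap.smul_apply, hφ t ht, smul_zero]

omit [IsTotallyReal F] in
/-- Sectors are closed under finite sums. [cite: Freitag1990, Ch. III §2, p. 145] -/
theorem IsInSector.sum {ι : Type*} {I : Finset (F →+* ℝ)} {z : Point F} (s : Finset ι)
    {φ : ι → Point F [⋀^Fin k]→L[ℝ] ℂ} (hφ : ∀ i ∈ s, IsInSector I z (φ i)) : IsInSector I z (∑ i ∈ s, φ i) :=
  fun t ht => by
    rw [ContinuousAlternatingMap.sum_apply]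
    exact Finset.sum_eq_zero fun i hi => hφ i hi t ht

omit [IsTotallyReal F] in
/-- **Freitag's form `c_t` lies in the sector `xPart t`** (Kronecker evaluation). [cite: Freitag1990, Ch. III §2, p. 145] -/
theorem coordForm_frameSymbols_isInSector {z : Point F} (hz : z ∈ halfSpace F) (t : FrameIdx F k) :
    IsInSector (xPart t) z (coordForm (frameSymbols t) z) := fun t' ht' => by
  rw [coordForm_apply_frameTuple hz, if_neg]
  rintro rfl
  exact ht' rfl

omit [IsTotallyReal F] in
/-- **Independence of sectors**: if `Σ_I φ_I = 0` with `φ_I` in sector `I` (`z ∈ ℍⁿ`), then every `φ_I = 0`.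
[cite: Freitag1990, Ch. III §2, p. 145] -/
theorem eq_zero_of_sum_eq_zero_of_isInSector {z : Point F} (hz : z ∈ halfSpace F)
    {φ : Finset (F →+* ℝ) → Point F [⋀^Fin k]→L[ℝ] ℂ} (hφ : ∀ I, IsInSector I z (φ I)) (h0 : ∑ I, φ I = 0)
    (I : Finset (F →+* ℝ)) : φ I = 0 := by
  refine eq_of_apply_frameTuple_eq hz fun t => ?_
  change φ I (frameTuple z t) = 0
  by_cases ht : xPart t = I
  · have h := congrArg (fun ψ : Point F [⋀^Fin k]→L[ℝ] ℂ => ψ (frameTuple z t)) h0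
    simp only [ContinuousAlternatingMap.sum_apply, ContinuousAlternatingMap.coe_zero, Pi.zero_apply] at h
    rw [Finset.sum_eq_single I (fun J _ hJ => hφ J t (by rw [ht]; exact Ne.symm hJ)) (fun h => absurd (Finset.mem_univ I) h)]
      at h
    exact h
  · exact hφ I t ht

omit [NumberField F] [IsTotallyReal F] in
/-- A form `(s_0, …, s_k)` whose symbol list is NOT injective vanishes on `ℍⁿ` (two equal columns).
[cite: Freitag1990, Ch. III §2, p. 143] -/
theorem coordForm_apply_eq_zero_of_not_injective {m : ℕ} {c : Fin m → (F →+* ℝ) ⊕ (F →+* ℝ)}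
    (hc : ¬ Function.Injective c) {z : Point F} (hz : z ∈ halfSpace F) (v : Fin m → Point F) : coordForm c z v = 0 := by
  rw [coordForm_apply_of_mem _ hz]
  obtain ⟨j₁, j₂, heq, hne⟩ := Function.not_injective_iff.1 hc
  rw [Matrix.det_zero_of_column_eq hne (fun i => by simp [Matrix.of_apply, heq]), Complex.ofReal_zero, smul_zero]

omit [IsTotallyReal F] in
/-- **Evaluation of a general `(s_1, …, s_m)` on a frame tuple vanishes unless the symbol sets agree**: if some `s_j`
does not occur in `t'`, then `coordForm s z (frameTuple z t') = 0` (a zero column). [cite: Freitag1990, Ch. III §2, p. 143] -/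
theorem coordForm_apply_frameTuple_eq_zero_of_not_mem {m : ℕ} (c : Fin m → (F →+* ℝ) ⊕ (F →+* ℝ)) {z : Point F}
    (hz : z ∈ halfSpace F) (t' : FrameIdx F m) {j : Fin m} (hj : c j ∉ Set.range (frameSymbols t')) :
    coordForm c z (frameTuple z t') = 0 := by
  rw [coordForm_apply_of_mem _ hz,
    Matrix.det_eq_zero_of_column_eq_zero j (fun i => by
      rw [Matrix.of_apply, frameTuple, coordCLM_frameVec, if_neg]
      exact fun h => hj ⟨i, h.symm⟩),
    Complex.ofReal_zero, smul_zero]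

omit [IsTotallyReal F] in
/-- **Prepending a `dy/y`-symbol keeps the sector**: `(dy_σ/y_σ, c_t)` lies in the sector `xPart t` at `z ∈ ℍⁿ`.
[cite: Freitag1990, Ch. III §2, p. 145] -/
theorem coordForm_cons_inr_isInSector {z : Point F} (hz : z ∈ halfSpace F) (t : FrameIdx F k) (σ : F →+* ℝ) :
    IsInSector (xPart t) z (coordForm (Fin.cons (Sum.inr σ) (frameSymbols t) : Fin (k + 1) → (F →+* ℝ) ⊕ (F →+* ℝ)) z) := by
  intro t' ht'
  set c : Fin (k + 1) → (F →+* ℝ) ⊕ (F →+* ℝ) := Fin.cons (Sum.inr σ) (frameSymbols t) with hc_def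
  by_cases hc : Function.Injective c
  · -- some symbol of `c` is missing from `t'`: otherwise the ranges agree and so do the `dx`-contents
    by_contra hne
    apply ht'
    have hall : ∀ j, c j ∈ Set.range (frameSymbols t') := fun j => by
      by_contra hj
      exact hne (coordForm_apply_frameTuple_eq_zero_of_not_mem c hz t' hj)
    have hsub : Finset.univ.image c ⊆ Finset.univ.image (frameSymbols t') := by
      intro s hs
      obtain ⟨j, -, rfl⟩ := Finset.mem_image.1 hs
      obtain ⟨i, hi⟩ := hall j
      exact Finset.mem_image.2 ⟨i, Finset.mem_univ _, hi⟩
    have hcard : (Finset.univ.image (frameSymbols t')).card ≤ (Finset.univ.image c).card := by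
      rw [Finset.card_image_of_injective _ hc, Finset.card_image_of_injective _ (frameSymbols_injective t')]
    have heq : Finset.univ.image c = Finset.univ.image (frameSymbols t') := Finset.eq_of_subset_of_card_le hsub hcard
    ext τ
    rw [mem_xPart_iff, mem_xPart_iff]
    have h1 : Sum.inl τ ∈ Set.range (frameSymbols t') ↔ Sum.inl τ ∈ Finset.univ.image (frameSymbols t') := by
      simp [Finset.mem_image]
    have h2 : Sum.inl τ ∈ Set.range (frameSymbols t) ↔ Sum.inl τ ∈ Finset.univ.image c := by
      simp only [Finset.mem_image, Finset.mem_univ, true_and, Set.mem_range, hc_def]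
      constructor
      · rintro ⟨i, hi⟩; exact ⟨i.succ, by simp [hi]⟩
      · rintro ⟨j, hj⟩
        refine Fin.cases ?_ (fun i hi => ⟨i, by simpa using hi⟩) j hj
        intro h; simp at h
    rw [h1, h2, heq]
  · exact coordForm_apply_eq_zero_of_not_injective hc hz _

end Sector

/-! ## §3 The sector pieces of a form; invariance -/

section Pieces

variable {Γ : Subgroup SL(2, F)} {k : ℕ}

/-- **The sector piece `ω_I = Σ_{xPart t = I} f_t • c_t`** of a form: the terms of its frame expansion containing
exactly the `x`-differentials `dx_σ`, `σ ∈ I`. [cite: Freitag1990, Ch. III §2, p. 145] -/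
def sectorPiece (α : Form F k) (I : Finset (F →+* ℝ)) : Form F k := fun z =>
  ∑ t ∈ Finset.univ.filter (fun t : FrameIdx F k => xPart t = I), formCoeff α t z • coordForm (frameSymbols t) z

omit [IsTotallyReal F] in
/-- Unfolding of `sectorPiece`. [cite: Freitag1990, Ch. III §2, p. 145] -/
theorem sectorPiece_apply (α : Form F k) (I : Finset (F →+* ℝ)) (z : Point F) :
    sectorPiece α I z =
      ∑ t ∈ Finset.univ.filter (fun t : FrameIdx F k => xPart t = I), formCoeff α t z • coordForm (frameSymbols t) z :=
  rfl

omit [IsTotallyReal F] in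
/-- The sector pieces vanish off `ℍⁿ`. [cite: Freitag1990, Ch. III §2, p. 142] -/
theorem sectorPiece_of_not_mem (α : Form F k) (I : Finset (F →+* ℝ)) {z : Point F} (hz : z ∉ halfSpace F) :
    sectorPiece α I z = 0 :=
  Finset.sum_eq_zero fun t _ => by rw [coordForm_of_not_mem _ hz, smul_zero]

omit [IsTotallyReal F] in
/-- **`Σ_I ω_I(z) = ω(z)` on `ℍⁿ`** (the frame expansion regrouped). [cite: Freitag1990, Ch. III §2, p. 145] -/
theorem sum_sectorPiece_apply_of_mem (α : Form F k) {z : Point F} (hz : z ∈ halfSpace F) :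
    ∑ I, sectorPiece α I z = α z := by
  simp only [sectorPiece_apply]
  rw [Finset.sum_fiberwise Finset.univ (fun t : FrameIdx F k => xPart t)
    (fun t => formCoeff α t z • coordForm (frameSymbols t) z)]
  exact (eq_sum_formCoeff_smul_coordForm α hz).symm

omit [IsTotallyReal F] in
/-- **`Σ_I ω_I = ω`** for a form vanishing off `ℍⁿ`. [cite: Freitag1990, Ch. III §2, p. 145] -/
theorem sum_sectorPiece {α : Form F k} (hα : ∀ z ∉ halfSpace F, α z = 0) : ∑ I, sectorPiece α I = α := by
  funext z
  rw [Finset.sum_apply]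
  by_cases hz : z ∈ halfSpace F
  · exact sum_sectorPiece_apply_of_mem α hz
  · rw [hα z hz]
    exact Finset.sum_eq_zero fun I _ => sectorPiece_of_not_mem α I hz

omit [IsTotallyReal F] in
/-- `ω_I(z)` lies in the sector `I`. [cite: Freitag1990, Ch. III §2, p. 145] -/
theorem sectorPiece_isInSector (α : Form F k) (I : Finset (F →+* ℝ)) {z : Point F} (hz : z ∈ halfSpace F) :
    IsInSector I z (sectorPiece α I z) :=
  IsInSector.sum _ fun t ht => by
    have htI : xPart t = I := (Finset.mem_filter.1 ht).2
    rw [← htI]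
    exact (coordForm_frameSymbols_isInSector hz t).smul _

omit [IsTotallyReal F] in
/-- **The coefficients of `ω_I`**: `f_t` for `xPart t = I`, `0` otherwise (`z ∈ ℍⁿ`). [cite: Freitag1990, Ch. III §2, p. 145] -/
theorem formCoeff_sectorPiece (α : Form F k) (I : Finset (F →+* ℝ)) (t : FrameIdx F k) {z : Point F}
    (hz : z ∈ halfSpace F) : formCoeff (sectorPiece α I) t z = if xPart t = I then formCoeff α t z else 0 := by
  rw [formCoeff_apply, sectorPiece_apply, ContinuousAlternatingMap.sum_apply]
  simp only [ContinuousAlternatingMap.smul_apply, coordForm_apply_frameTuple hz, smul_eq_mul, mul_ite, mul_one, mul_zero]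
  rw [Finset.sum_ite_eq]
  simp only [Finset.mem_filter, Finset.mem_univ, true_and]

omit [IsTotallyReal F] in
/-- The sector pieces of a form smooth on `ℍⁿ` are smooth on `ℍⁿ`. [cite: Freitag1990, Ch. III §2, p. 145] -/
theorem contDiffOn_sectorPiece {α : Form F k} (hα : ContDiffOn ℝ ∞ α (halfSpace F)) (I : Finset (F →+* ℝ)) :
    ContDiffOn ℝ ∞ (sectorPiece α I) (halfSpace F) :=
  ContDiffOn.sum fun t _ => (contDiffOn_formCoeff hα t).smul (contDiffOn_coordForm _)

omit [NumberField F] [IsTotallyReal F] in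
/-- Pull-back by a fixed linear map is compatible with frame combinations. [folklore] -/
private theorem sum_smul_compContinuousLinearMap {ι : Type*} (s : Finset ι) (a : ι → ℂ)
    (β : ι → Point F [⋀^Fin k]→L[ℝ] ℂ) (L : Point F →L[ℝ] Point F) :
    (∑ i ∈ s, a i • β i).compContinuousLinearMap L = ∑ i ∈ s, a i • (β i).compContinuousLinearMap L := by
  ext v
  simp [ContinuousAlternatingMap.sum_apply, ContinuousAlternatingMap.compContinuousLinearMap_apply]

omit [NumberField F] [IsTotallyReal F] in
/-- The two ways of writing the sector character of a symbol list agree: `Π_j Sum.elim (σ ↦ σ(e)²) 1 (c_j) =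
Π_j charFactor (e²) (c_j)`. [cite: Freitag1990, Ch. III §2, p. 145] -/
theorem prod_elim_sq_eq_prod_charFactor {m : ℕ} (c : Fin m → (F →+* ℝ) ⊕ (F →+* ℝ)) (e : Fˣ) :
    (∏ j, Sum.elim (fun σ => σ (e : F) ^ 2) (fun _ => (1 : ℝ)) (c j)) = ∏ j, charFactor ((e ^ 2 : Fˣ) : F) (c j) := by
  refine Finset.prod_congr rfl fun j _ => ?_
  cases c j with
  | inl σ => simp [Units.val_pow_eq_pow_val, map_pow]
  | inr σ => simp

omit [IsTotallyReal F] in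
/-- **The sector pieces of a `Γ_∞`-invariant form are `Γ_∞`-invariant**: under `γ = (e m; 0 e⁻¹)` both `f_t` and
`c_t` transform by the character `Π_{σ ∈ xPart t} σ(e²)^{∓1}`, which cancels. [cite: Freitag1990, Ch. III §2, p. 145
(«invariant under `z ↦ εz + b`»)] -/
theorem isInvariantForm_sectorPiece {α : Form F k} (hα : α ∈ invariantForms (stabInfty Γ) k) (I : Finset (F →+* ℝ)) :
    IsInvariantForm (stabInfty Γ) (sectorPiece α I) := by
  rintro γ ⟨hγ, hγ0⟩ z hz
  obtain ⟨e, -, -, he⟩ := exists_eq_upperTri_of_apply_one_zero hγ0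
  have hinv : moebPullback γ α z = α z := (mem_invariantForms_iff.1 hα).2.1 γ ⟨hγ, hγ0⟩ z hz
  rw [he] at hinv ⊢
  set m := γ 0 1
  have hcoef : ∀ t : FrameIdx F k, formCoeff α t (moeb (upperTri e m) z) *
      (∏ j, charFactor ((e ^ 2 : Fˣ) : F) (frameSymbols t j) : ℝ) = formCoeff α t z := fun t => by
    have h := formCoeff_moebPullback_upperTri α e m t z
    rw [formCoeff_apply, hinv, ← formCoeff_apply] at h
    rw [h, Complex.real_smul, mul_comm]
  rw [moebPullback_def, sectorPiece_apply, sum_smul_compContinuousLinearMap, sectorPiece_apply]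
  refine Finset.sum_congr rfl fun t _ => ?_
  rw [← moebPullback_def, moebPullback_coordForm_upperTri _ e m hz, prod_elim_sq_eq_prod_charFactor, ← hcoef t,
    mul_comm, ← smul_smul, Complex.coe_smul]
  exact smul_comm _ _ _

omit [IsTotallyReal F] in
/-- **`ω_I ∈ M^k(ℍⁿ)^{Γ_∞}` for `ω ∈ M^k(ℍⁿ)^{Γ_∞}`.** [cite: Freitag1990, Ch. III §2, p. 145] -/
theorem sectorPiece_mem_invariantForms {α : Form F k} (hα : α ∈ invariantForms (stabInfty Γ) k) (I : Finset (F →+* ℝ)) :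
    sectorPiece α I ∈ invariantForms (stabInfty Γ) k :=
  mem_invariantForms_iff.2 ⟨contDiffOn_sectorPiece (mem_invariantForms_iff.1 hα).1 I, isInvariantForm_sectorPiece hα I,
    fun _ hz => sectorPiece_of_not_mem α I hz⟩

end Pieces

/-! ## §4 For `x`-independent closed forms the sector pieces are closed -/

section Closed

variable {Γ : Subgroup SL(2, F)} {k : ℕ}

omit [IsTotallyReal F] in
/-- **`d(f • c_t)(z) = Σ_s df(z)(frameVec z s) • (s, c_t)(z)` on `ℍⁿ`**: the Leibniz rule in Freitag's frame
(`c_t` is closed). [cite: Freitag1990, Ch. III §1, p. 133 («`dω = Σ ∂f/∂x … ∧ dx_a`»)] -/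
theorem extDeriv_smul_coordForm {f : Point F → ℂ} (c : Fin k → (F →+* ℝ) ⊕ (F →+* ℝ)) {z : Point F}
    (hz : z ∈ halfSpace F) (hf : DifferentiableAt ℝ f z) :
    extDeriv (fun w => f w • coordForm c w) z =
      ∑ s, fderiv ℝ f z (frameVec z s) • coordForm (Fin.cons s c : Fin (k + 1) → (F →+* ℝ) ⊕ (F →+* ℝ)) z := by
  have hc : DifferentiableAt ℝ (coordForm c) z :=
    ((contDiffOn_coordForm c).differentiableOn (by simp)).differentiableAt (isOpen_halfSpace.mem_nhds hz)
  rw [extDeriv_smul_eq_wedgeOne_add hf hc, extDeriv_coordForm c hz, smul_zero, add_zero]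
  conv_lhs => rw [eq_sum_apply_frameVec_smul_frameCovector hz (fderiv ℝ f z)]
  have hsum : ∀ (S : Finset ((F →+* ℝ) ⊕ (F →+* ℝ))),
      wedgeOne (∑ s ∈ S, fderiv ℝ f z (frameVec z s) • frameCovector z s) (coordForm c z) =
        ∑ s ∈ S, fderiv ℝ f z (frameVec z s) • coordForm (Fin.cons s c : Fin (k + 1) → (F →+* ℝ) ⊕ (F →+* ℝ)) z := by
    intro S
    induction S using Finset.induction_on with
    | empty =>
      ext v
      simp [wedgeOne_apply]
    | insert a S ha ih =>
      rw [Finset.sum_insert ha, Finset.sum_insert ha, wedgeOne_add_left, wedgeOne_smul_left, wedgeOne_coordForm a c hz, ih]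
  exact hsum Finset.univ

omit [IsTotallyReal F] in
/-- **For `x`-independent `f`, `d(f • c_t)(z)` lies in the sector of `t`**: only the `dy/y`-directions contribute.
[cite: Freitag1990, Ch. III §2, p. 145] -/
theorem extDeriv_smul_coordForm_isInSector {f : Point F → ℂ} (hfx : ∀ z x, f (z + realToPoint F x) = f z)
    (t : FrameIdx F k) {z : Point F} (hz : z ∈ halfSpace F) (hf : DifferentiableAt ℝ f z) :
    IsInSector (xPart t) z (extDeriv (fun w => f w • coordForm (frameSymbols t) w) z) := by
  rw [extDeriv_smul_coordForm _ hz hf]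
  refine IsInSector.sum _ fun s _ => ?_
  cases s with
  | inl σ =>
    have h0 : fderiv ℝ f z (frameVec z (Sum.inl σ)) = 0 := by
      rw [frameVec, coordWeight_inl, one_smul, show unitVec F (Sum.inl σ) = realToPoint F (Pi.single σ 1) from rfl]
      exact fderiv_realToPoint_eq_zero hfx hf _
    rw [h0, zero_smul]
    exact isInSector_zero _ _
  | inr σ => exact (coordForm_cons_inr_isInSector hz t σ).smul _

omit [IsTotallyReal F] in
/-- **`d(ω_I)(z)` lies in the sector `I`** for an `x`-independent form smooth on `ℍⁿ`. [cite: Freitag1990, Ch. III §2, p. 145] -/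
theorem extDeriv_sectorPiece_isInSector {α : Form F k} (hαs : ContDiffOn ℝ ∞ α (halfSpace F))
    (hαx : ∀ z x, α (z + realToPoint F x) = α z) (I : Finset (F →+* ℝ)) {z : Point F} (hz : z ∈ halfSpace F) :
    IsInSector I z (extDeriv (sectorPiece α I) z) := by
  have hdf : ∀ t : FrameIdx F k, DifferentiableAt ℝ (formCoeff α t) z := fun t =>
    (((contDiffOn_formCoeff hαs t).differentiableOn (by simp)).differentiableAt (isOpen_halfSpace.mem_nhds hz))
  have hdc : ∀ t : FrameIdx F k, DifferentiableAt ℝ (coordForm (frameSymbols t) : Form F k) z := fun t =>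
    ((contDiffOn_coordForm (frameSymbols t)).differentiableOn (by simp)).differentiableAt (isOpen_halfSpace.mem_nhds hz)
  have h1 : extDeriv (sectorPiece α I) z =
      ∑ t ∈ Finset.univ.filter (fun t : FrameIdx F k => xPart t = I),
        extDeriv (fun w => formCoeff α t w • coordForm (frameSymbols t) w) z := by
    rw [show sectorPiece α I = ∑ t ∈ Finset.univ.filter (fun t : FrameIdx F k => xPart t = I),
      (fun w => formCoeff α t w • coordForm (frameSymbols t) w) from by funext w; rw [Finset.sum_apply]; rfl]
    exact extDeriv_finset_sum _ fun t _ => (hdf t).smul (hdc t)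
  rw [h1]
  refine IsInSector.sum _ fun t ht => ?_
  have htI : xPart t = I := (Finset.mem_filter.1 ht).2
  rw [← htI]
  exact extDeriv_smul_coordForm_isInSector (fun w x => formCoeff_add_realToPoint hαx t w x) t hz (hdf t)

omit [IsTotallyReal F] in
/-- **The sector pieces of an `x`-independent closed `Γ_∞`-invariant form are closed**: `Σ_I dω_I = dω = 0` with
`dω_I` in sector `I`, and the sectors are independent. [cite: Freitag1990, Ch. III §2, proof of Prop. 2.1, p. 145] -/
theorem extDeriv_sectorPiece_eq_zero {α : Form F k} (hα : α ∈ closedForms (stabInfty Γ) k)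
    (hαx : ∀ z x, α (z + realToPoint F x) = α z) (I : Finset (F →+* ℝ)) {z : Point F} (hz : z ∈ halfSpace F) :
    extDeriv (sectorPiece α I) z = 0 := by
  obtain ⟨hαi, hαd⟩ := (mem_closedForms_iff (stabInfty Γ) α).1 hα
  obtain ⟨hαs, -, hα0⟩ := mem_invariantForms_iff.1 hαi
  have hdiff : ∀ J : Finset (F →+* ℝ), DifferentiableAt ℝ (sectorPiece α J) z := fun J =>
    ((contDiffOn_sectorPiece hαs J).differentiableOn (by simp)).differentiableAt (isOpen_halfSpace.mem_nhds hz)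
  have hsum : ∑ J, extDeriv (sectorPiece α J) z = 0 := by
    rw [← extDeriv_finset_sum Finset.univ fun J _ => hdiff J, sum_sectorPiece hα0]
    exact hαd z hz
  exact eq_zero_of_sum_eq_zero_of_isInSector hz (fun J => extDeriv_sectorPiece_isInSector hαs hαx J hz) hsum I

omit [IsTotallyReal F] in
/-- **`ω_I ∈ closedForms Γ_∞`** for an `x`-independent `ω ∈ closedForms Γ_∞`. [cite: Freitag1990, Ch. III §2, p. 145] -/
theorem sectorPiece_mem_closedForms {α : Form F k} (hα : α ∈ closedForms (stabInfty Γ) k)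
    (hαx : ∀ z x, α (z + realToPoint F x) = α z) (I : Finset (F →+* ℝ)) :
    sectorPiece α I ∈ closedForms (stabInfty Γ) k :=
  (mem_closedForms_iff (stabInfty Γ) _).2 ⟨sectorPiece_mem_invariantForms (closedForms_le_invariantForms _ _ hα) I,
    fun _ hz => extDeriv_sectorPiece_eq_zero hα hαx I hz⟩

omit [IsTotallyReal F] in
/-- **`[ω] = Σ_I [ω_I]` in `H^k((ℍⁿ, Γ_∞))`** for an `x`-independent closed invariant `ω`.
[cite: Freitag1990, Ch. III §2, proof of Prop. 2.1, p. 145] -/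
theorem mk_eq_sum_mk_sectorPiece {α : Form F k} (hα : α ∈ closedForms (stabInfty Γ) k)
    (hαx : ∀ z x, α (z + realToPoint F x) = α z) :
    HilbertModular.deRhamCohomology.mk (stabInfty Γ) k ⟨α, hα⟩ =
      ∑ I, HilbertModular.deRhamCohomology.mk (stabInfty Γ) k ⟨sectorPiece α I, sectorPiece_mem_closedForms hα hαx I⟩ := by
  rw [← _root_.map_sum]
  congr 1
  apply Subtype.ext
  rw [Submodule.coe_sum]
  exact (sum_sectorPiece (mem_invariantForms_iff.1 (closedForms_le_invariantForms _ _ hα)).2.2).symm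

end Closed

end Literature.NumberTheory.Automorphic.HilbertModular
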